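import Summits.ABC.IUTFork.Cor312PilotKummerCompat
import Summits.ABC.IUTFork.Cor312PilotIdelesPrCapstone
import Summits.ABC.IUTFork.Thm311Real3
import Summits.ABC.ABC.Theorems.IUTThetaPilotThetaPartIIULineCapstone
import HarnessLib

/-!
# Branch C certificate, INTAKE companion 4: the HULL-LEVEL line at the assembled real setting over an ARBITRARY base field —
# the q-number back as an explicit READ binder (after FINDING C-cert-3-F1), no provenance over `F`, no realising ideles demanded

C scoreboard, companion Shrink4 (`abc_of_SH_shrink4`): S_H 1 · PIN 1 (q-pin) · FACT 0 · CONE 1 (`hreg`) · READ 2 (`hΘ` one-sided, `hq`) · SIDE 4 = 9 (explicit) / EFFECTIVE 21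
EFFECTIVE Prop hypotheses: explicit 11 + transitive structure fields 10 = 21 [FACT-LIST 1 · SUMMIT-PROP 0 · LITERATURE-PROP 0 · CORE 6 · COMPOUND 3 · other 0 · nested structures 0] (v3: fields of project-structure DATA binders, depth ≤ 4, a nested structure type is expanded once per binder); BUNDLE-EXPANDED explicit = 11 (v3.9: each ∀/∃/∧-packed binder replaced by its leaf hypotheses)
(tool line VERBATIM, abc-iut-w5-d035 `HypAuditScan.lean`; «explicit 11» = the 9 `Prop` binders + the 2 instance-class binders `[∀ P l T, NumberField (Fld P l T)]`,
`[∀ P l T, NumberField (M P l T)]`; the 10 structure fields = X 4 · lat 2 · sig 2 · split 1 · qData 1.)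
Reference: v4 `abc_of_S_v4` (p431657) apex 2/2, per datum 11 named — whose side group `hX ∧ htq` is UNSATISFIABLE at every genuine datum
(`Conditional.SideVacuity.sideConditions_unsat_of_isPilotDataOf`, p432420: realising q-ideles over the field `F` of the initial Θ-datum do not
exist, [IUTchI] Def. 3.1 (c)); Shrink3 (p431459) 10/21, same defect.

PROOF-ONLY companion (no `def`, no new `Prop`) by the INTAKE seat abc-iut-C-cert-3. WHY THIS SHAPE. FINDING C-cert-3-F1 (p432420) shows that
the two devices by which v3/v4 (and Shrink2/3) «discharged» the q-side reading — abc-iut-c312-8's provenance `IsPilotDataOf D X` (pilot data over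
`D`'s field `F`) and abc-iut-c312-7's `negLogQ_settingPrVolSharp_eq_neg_absLogq` (q-ideles in `F_v` REALISING `P_q`) — cannot hold together:
Def. 3.1 (c) (`l ∤ ord_v(q_v)`) forbids realising ideles over `F`. Print computes in `K = F(E_F[l])` (Ex. 3.2 (iv): `q_v^{1/2l} ∈ K_v̲`). Until a
`K`-level provenance is DEFINED (repair R1, owner to be named by the C lead), the honest certificate is FIELD-GENERIC: the Dupuy–Hilado pilot
data `X : PilotData F` live over an ARBITRARY number field `F` (to be instantiated at `K`, where realising ideles exist —
`exists_realising_qIdeles` p420764 — and the degree-normalised q-number is `−(1/2l)·log(q)`), NO provenance binder ties `X` to the datum, NO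
realisation is demanded of the ideles (only abc-iut-c312-7's setting-forming conditions: non-zero, units off `S`), and the two NUMBER
identifications are explicit READ binders exactly as in v2 (p428991): `hq : P.negLogQ = T.negAbsLogQ` (the q-side; at `F := K` it is the content
of the future `K`-level provenance theorem) and `hΘ : P.negLogTheta ≤ ↑T.negLogTheta` (the Θ-side, one-sided; OPEN, owners c312-7 / S7 / S3).
What stays DISCHARGED by name at this generality: `BridgeHyps` incl. `ThetaFinite` (`bridgeHyps_settingPrVolSharp_of_ideles`, p424856), the whole
Thm-3.11 input (the hull-level line needs none: w5-d068 `statement_of_pilotKummerCompatHull`), [GenEll] Thm 2.1 at Σ = {2}, (P7), the slot-constant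
hull volumes (c312-8 `ABC_of_cor312_of_hullRegime`, p428563).

PER DATUM (explicit `Prop` binders of `Shrink4.le_of_SH`, a statement about two real numbers `nq`, `nΘ`): [S_H] `hSH` · [PIN] `hQPin` · [READ] `hq`,
`hΘ` · [SIDE] `htq0 htq1 ht0 ht1` (trivially satisfiable: `t = tq = 1`; every honest choice too). NO `hX`, NO `htq`, NO `hplaces`, NO `hI`. The
content of the antecedent is therefore carried JOINTLY by `hSH ∧ hQPin ∧ hq ∧ hΘ` — which is where it belongs: at `F := K` with realising ideles
`hq` is a theorem-to-be (R1) and `hSH ∧ hQPin ∧ hΘ` is the adjudication object in volume form (E3, C-R15: refuted at DEEP packets in radii form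
p432372; at shallow data = the typed Θ-side inequality). Apex `abc_of_SH_shrink4`: per (P, l, T) a base field `Fld P l T` (free; NOT `T.F`),
pilot data and containers over it, the binders above, and the (P,l)-level CONE binder `hreg` (v4's, verbatim) ⟹ `ABC` via c312-8's capstone.

HONEST FRAMING: this campaign LOCATES / CONDITIONALLY VERIFIES. Nothing here asserts that abc is proved or refuted, or that [IUTchIII] Cor. 3.12 /
Thm. 3.11 holds or fails, or takes a side on any author (Mochizuki / Scholze–Stix / Joshi / Dupuy–Hilado); «`ABC` follows from S_H + the listed
hypotheses AS TYPED, at these data», nothing more; S_H is an assumption label; typed ≠ proved; instantiated ≠ endorsed.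
[claim: Mochizuki2012, status: disputed] [cite: Mochizuki2012, IUTchI Def. 3.1 (c) p. 61, Ex. 3.2 (iv) p. 71; IUTchIII Cor. 3.12 Step (xi-d) p. 183]
[cite: DupuyHilado2025, §3.3–§3.4]
-/

noncomputable section

open Set Function NumberField IsDedekindDomain

namespace Summit.ABC.IUTFork.Conditional

open Thm311 Thm311.Real Cor312 Cor312Vol Literature.IUT.LogThetaLattice Literature.IUT.LogVolume
  Literature.IUT.HodgeTheaters

/-! ## §1. One setting over ANY base field: `nq ≤ nΘ` from S_H + q-pin + the two readings + setting-forming side conditions -/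

section PerDatum

variable {F : Type} [Field F] [NumberField F] (X : PilotData F) (M : Type) [Field M] [NumberField M]
  (archPk : ∀ (j : (thetaIndex X).Label) (vQ : (thetaIndex X).VQ), Set ((logShellsDH X (analyticLogv F)).Packet j vQ))
  (archSub : ∀ (j : (thetaIndex X).Label) (v : (thetaIndex X).V),
    Set ((logShellsDH X (analyticLogv F)).Packet j ((thetaIndex X).over v)))
  (Ψ : ℤ → ∀ v : (thetaIndex X).V, v ∈ (thetaIndex X).Vbad → Set ((logShellsDH X (analyticLogv F)).StarPacket v))
  (act : ℤ → ∀ v : (thetaIndex X).V, v ∈ (thetaIndex X).Vbad →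
    (logShellsDH X (analyticLogv F)).StarPacket v → Module.End ℚ ((logShellsDH X (analyticLogv F)).StarPacket v))
  (Mmod : ℤ → ∀ j : (thetaIndex X).LabelStar, Set ((logShellsDH X (analyticLogv F)).GlobalPacket j.1))
  (region : ℤ → ∀ j : (thetaIndex X).LabelStar, FinDivisor M → ∀ vQ : (thetaIndex X).VQ,
    Set ((logShellsDH X (analyticLogv F)).Packet j.1 vQ))
  (frobAdm : ℤ → ℤ → ∀ (j : (thetaIndex X).Label) (vQ : (thetaIndex X).VQ),
    Set ((logShellsDH X (analyticLogv F)).Packet j vQ) → Prop)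
  (frobLogvol : ℤ → ℤ → ∀ (j : (thetaIndex X).Label) (vQ : (thetaIndex X).VQ),
    Set ((logShellsDH X (analyticLogv F)).Packet j vQ) → ℝ)
  (frobΨ : ℤ → ℤ → ∀ v : (thetaIndex X).V, v ∈ (thetaIndex X).Vbad → Set ((logShellsDH X (analyticLogv F)).StarPacket v))
  (frobMmod : ℤ → ℤ → ∀ j : (thetaIndex X).LabelStar, Set ((logShellsDH X (analyticLogv F)).GlobalPacket j.1))
  (unitImage : ℤ → ℤ → ℕ → ∀ (j : (thetaIndex X).Label) (vQ : (thetaIndex X).VQ),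
    Set ((logShellsDH X (analyticLogv F)).Packet j vQ))
  (ballImage : ℤ → ℤ → ∀ (j : (thetaIndex X).Label) (vQ : (thetaIndex X).VQ),
    Set ((logShellsDH X (analyticLogv F)).Packet j vQ))
  (thetaDiv : ℤ → ℤ → LgpDivisor M (thetaIndex X).lstar)
  (n : ℤ) {HT : Type} {LogLink : HT → HT → Type} {IsFull : ∀ {s t : HT}, LogLink s t → Prop}
  (lat : LGPGaussianLogThetaLattice LogLink IsFull)
  {Frd : Type} {IsoF : Frd → Frd → Type} {Ob : Frd → Type} {realify : Frd → Frd} {Strip : Type}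
  {IsoS : Strip → Strip → Type} {Mv : ∀ v : (thetaIndex X).V, v ∈ (thetaIndex X).Vbad → Type}
  [∀ v h, Monoid (Mv v h)]
  (sig : GlobalLGPFrobenioidSignature (thetaIndex X).lstar (thetaIndex X).V (· ∈ (thetaIndex X).Vbad)
    Frd IsoF Ob realify Strip IsoS Mv)
  (split : SplittingMonoids Mv) {ObΔ : Type} {N : ∀ v : (thetaIndex X).V, v ∈ (thetaIndex X).Vbad → Type}
  [∀ v h, Monoid (N v h)] (qData : QPilotData ObΔ N)
  (t : ∀ (pp : Nat.Primes) (_ : Fin X.lstar) (x : (thetaIndex X).Fibre (.inr pp)),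
    haveI : Fact (pp : ℕ).Prime := ⟨pp.2⟩; kOf X pp.1 x)
  (tq : ∀ (pp : Nat.Primes) (x : (thetaIndex X).Fibre (.inr pp)), haveI : Fact (pp : ℕ).Prime := ⟨pp.2⟩; kOf X pp.1 x)
  (ρ : (∀ v : (thetaIndex X).V, v ∈ (thetaIndex X).Vbad → Set ((logShellsDH X (analyticLogv F)).StarPacket v)) →
    ∀ (j : (thetaIndex X).Label) (vQ : (thetaIndex X).VQ), Set ((logShellsDH X (analyticLogv F)).Packet j vQ))
  (qK : ∀ v : (thetaIndex X).V, v ∈ (thetaIndex X).Vbad → Set ((logShellsDH X (analyticLogv F)).StarPacket v))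

/-- **One assembled real setting over an arbitrary number field `F`, HULL-LEVEL line: the read numbers satisfy `nq ≤ nΘ`** FROM S_H
(`PilotKummerCompatHull`), the q-pin, `hq : −|log(q)|` of the setting `= nq`, `hΘ : −|log(Θ)|` of the setting `≤ nΘ`, and abc-iut-c312-7's
setting-forming idele conditions (non-zero, units off `S`; NO realisation demanded — see FINDING C-cert-3-F1, p432420). Route: c312-7
`bridgeHyps_settingPrVolSharp_of_ideles` (p424856) + w5-d068 `statement_of_pilotKummerCompatHull` ⟹ the verbatim `Statement`; then the two readings.
«`nq ≤ nΘ` follows from S_H + these hypotheses as typed, at these data» — no side taken. [claim: Mochizuki2012, status: disputed] -/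
theorem Shrink4.le_of_SH {nq nΘ : ℝ} (htq0 : ∀ pp x, tq pp x ≠ 0)
    (htq1 : ∀ (pp : Nat.Primes) (x : (thetaIndex X).Fibre (.inr pp)),
      haveI : Fact (pp : ℕ).Prime := ⟨pp.2⟩; placeOf X pp.1 x ∉ X.S → ‖tq pp x‖ = 1)
    (ht0 : ∀ pp i x, t pp i x ≠ 0)
    (ht1 : ∀ (pp : Nat.Primes) (i : Fin X.lstar) (x : (thetaIndex X).Fibre (.inr pp)),
      haveI : Fact (pp : ℕ).Prime := ⟨pp.2⟩; placeOf X pp.1 x ∉ X.S → ‖t pp i x‖ = 1)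
    (hSH : Cor312Vol.PilotKummerCompatHull
      (LatticeSituation.ofShells (logShellsDH X (analyticLogv F)) M archPk archSub
        (summandPiecesPr X (logvAnalytic_analyticLogv (F := F))).Adm
        (summandPiecesPr X (logvAnalytic_analyticLogv (F := F))).logvol Ψ act Mmod region frobAdm frobLogvol frobΨ
        frobMmod unitImage ballImage thetaDiv)
      (settingPrVolSharp X (logvAnalytic_analyticLogv (F := F)) M archPk archSub Ψ act Mmod region n lat sig split qData
        tq t htq0 htq1) ρ qK)
    (hQPin : Cor312Vol.QPinned
      (LatticeSituation.ofShells (logShellsDH X (analyticLogv F)) M archPk archSub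
        (summandPiecesPr X (logvAnalytic_analyticLogv (F := F))).Adm
        (summandPiecesPr X (logvAnalytic_analyticLogv (F := F))).logvol Ψ act Mmod region frobAdm frobLogvol frobΨ
        frobMmod unitImage ballImage thetaDiv)
      (settingPrVolSharp X (logvAnalytic_analyticLogv (F := F)) M archPk archSub Ψ act Mmod region n lat sig split qData
        tq t htq0 htq1) ρ qK)
    (hq : (settingPrVolSharp X (logvAnalytic_analyticLogv (F := F)) M archPk archSub Ψ act Mmod region n lat sig split qData
        tq t htq0 htq1).negLogQ = nq)
    (hΘ : (settingPrVolSharp X (logvAnalytic_analyticLogv (F := F)) M archPk archSub Ψ act Mmod region n lat sig split qData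
        tq t htq0 htq1).negLogTheta ≤ ((nΘ : ℝ) : WithTop ℝ)) :
    nq ≤ nΘ := by
  have hst :
      (settingPrVolSharp X (logvAnalytic_analyticLogv (F := F)) M archPk archSub Ψ act Mmod region n lat sig split qData
        tq t htq0 htq1).Statement :=
    Cor312Vol.statement_of_pilotKummerCompatHull
      (LatticeSituation.ofShells (logShellsDH X (analyticLogv F)) M archPk archSub
        (summandPiecesPr X (logvAnalytic_analyticLogv (F := F))).Adm
        (summandPiecesPr X (logvAnalytic_analyticLogv (F := F))).logvol Ψ act Mmod region frobAdm frobLogvol frobΨ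
        frobMmod unitImage ballImage thetaDiv)
      (settingPrVolSharp X (logvAnalytic_analyticLogv (F := F)) M archPk archSub Ψ act Mmod region n lat sig split qData
        tq t htq0 htq1) ρ qK
      (bridgeHyps_settingPrVolSharp_of_ideles X (logvAnalytic_analyticLogv (F := F)) M archPk archSub Ψ act Mmod region n lat
        sig split qData t tq ht0 ht1 htq0 htq1)
      hQPin hSH
  obtain ⟨-, hle⟩ := hst
  rw [hq] at hle
  exact WithTop.coe_le_coe.mp (hle.trans hΘ)

end PerDatum

/-! ## §2. The apex, unbundled, base field FREE per datum: S_H + q-pin + two readings + setting-forming side conditions + hull REGIME ⟹ `ABC` -/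

section Family

open Literature.NumberTheory.DiophantineGeometry.GenEll Summit.ABC.ABC.Theorems

/-- **`abc_of_SH_shrink4` (branch C, HULL-LEVEL line, FIELD-GENERIC; per datum explicit S_H 1 · PIN 1 · FACT 0 · READ 2 · SIDE 4, plus the
(P,l)-level CONE binder `hreg`).** `ABC` from, per `λ`-line point `P`, prime `l` and genuine Θ-volume datum `T : Cor22.ThetaVolumeDatumAt P l`:
DATA = a number field `Fld P l T` (FREE — instantiate at `K = F(E_F[l])` of `T.D`, where realising ideles exist; NOT tied to `T` by any provenance
binder), Dupuy–Hilado pilot data `X P l T` over it, the context binders of abc-iut-c312-7's print-normalised real setting with FREE columns,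
ideles, PR-1's `ρ`, `qK`; HYPOTHESES = [SIDE] `htq0 htq1 ht0 ht1` (setting-forming only; satisfiable trivially) · [S_H] `hSH` · [PIN] `hQPin` ·
[READ] `hq` (the setting's `−|log(q)|` IS the datum's `T.negAbsLogQ`; at `K` the content of the K-level provenance theorem wanted under
repair R1 of FINDING C-cert-3-F1), `hΘ` (one-sided Θ-side) · [CONE] `hreg` (v4's, verbatim; c312-8 `ABC_of_cor312_of_hullRegime` p428563).
Proof: §1 at `nq := T.negAbsLogQ`, `nΘ := T.negLogTheta` gives `Cor22.Cor312AtDatum P l`; then the (U)-line capstone. «`ABC` follows from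
S_H + these hypotheses as typed, at these data» — no side taken on [IUTchIII] Cor. 3.12; typed ≠ proved; instantiated ≠ endorsed.
[claim: Mochizuki2012, status: disputed] -/
theorem abc_of_SH_shrink4
    -- DATA, per datum: a FREE base field, pilot data over it, the context binders of the assembled real setting (logs FIXED: analytic), ideles, ρ, qK
    (Fld : ∀ (P : NFPoint) (l : ℕ) (T : Cor22.ThetaVolumeDatumAt P l), Type) [∀ P l T, Field (Fld P l T)] [∀ P l T, NumberField (Fld P l T)]
    (X : ∀ (P : NFPoint) (l : ℕ) (T : Cor22.ThetaVolumeDatumAt P l), PilotData (Fld P l T))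
    (M : ∀ (P : NFPoint) (l : ℕ) (T : Cor22.ThetaVolumeDatumAt P l), Type) [∀ P l T, Field (M P l T)] [∀ P l T, NumberField (M P l T)]
    (archPk : ∀ (P : NFPoint) (l : ℕ) (T : Cor22.ThetaVolumeDatumAt P l), ∀ (j : (thetaIndex (X P l T)).Label) (vQ : (thetaIndex (X P l T)).VQ), Set ((logShellsDH (X P l T) (analyticLogv (Fld P l T))).Packet j vQ))
    (archSub : ∀ (P : NFPoint) (l : ℕ) (T : Cor22.ThetaVolumeDatumAt P l), ∀ (j : (thetaIndex (X P l T)).Label) (v : (thetaIndex (X P l T)).V), Set ((logShellsDH (X P l T) (analyticLogv (Fld P l T))).Packet j ((thetaIndex (X P l T)).over v)))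
    (Ψ : ∀ (P : NFPoint) (l : ℕ) (T : Cor22.ThetaVolumeDatumAt P l), ℤ → ∀ v : (thetaIndex (X P l T)).V, v ∈ (thetaIndex (X P l T)).Vbad → Set ((logShellsDH (X P l T) (analyticLogv (Fld P l T))).StarPacket v))
    (act : ∀ (P : NFPoint) (l : ℕ) (T : Cor22.ThetaVolumeDatumAt P l), ℤ → ∀ v : (thetaIndex (X P l T)).V, v ∈ (thetaIndex (X P l T)).Vbad → (logShellsDH (X P l T) (analyticLogv (Fld P l T))).StarPacket v → Module.End ℚ ((logShellsDH (X P l T) (analyticLogv (Fld P l T))).StarPacket v))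
    (Mmod : ∀ (P : NFPoint) (l : ℕ) (T : Cor22.ThetaVolumeDatumAt P l), ℤ → ∀ j : (thetaIndex (X P l T)).LabelStar, Set ((logShellsDH (X P l T) (analyticLogv (Fld P l T))).GlobalPacket j.1))
    (region : ∀ (P : NFPoint) (l : ℕ) (T : Cor22.ThetaVolumeDatumAt P l), ℤ → ∀ j : (thetaIndex (X P l T)).LabelStar, FinDivisor (M P l T) → ∀ vQ : (thetaIndex (X P l T)).VQ, Set ((logShellsDH (X P l T) (analyticLogv (Fld P l T))).Packet j.1 vQ))
    (frobAdm : ∀ (P : NFPoint) (l : ℕ) (T : Cor22.ThetaVolumeDatumAt P l), ℤ → ℤ → ∀ (j : (thetaIndex (X P l T)).Label) (vQ : (thetaIndex (X P l T)).VQ), Set ((logShellsDH (X P l T) (analyticLogv (Fld P l T))).Packet j vQ) → Prop)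
    (frobLogvol : ∀ (P : NFPoint) (l : ℕ) (T : Cor22.ThetaVolumeDatumAt P l), ℤ → ℤ → ∀ (j : (thetaIndex (X P l T)).Label) (vQ : (thetaIndex (X P l T)).VQ), Set ((logShellsDH (X P l T) (analyticLogv (Fld P l T))).Packet j vQ) → ℝ)
    (frobΨ : ∀ (P : NFPoint) (l : ℕ) (T : Cor22.ThetaVolumeDatumAt P l), ℤ → ℤ → ∀ v : (thetaIndex (X P l T)).V, v ∈ (thetaIndex (X P l T)).Vbad → Set ((logShellsDH (X P l T) (analyticLogv (Fld P l T))).StarPacket v))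
    (frobMmod : ∀ (P : NFPoint) (l : ℕ) (T : Cor22.ThetaVolumeDatumAt P l), ℤ → ℤ → ∀ j : (thetaIndex (X P l T)).LabelStar, Set ((logShellsDH (X P l T) (analyticLogv (Fld P l T))).GlobalPacket j.1))
    (unitImage : ∀ (P : NFPoint) (l : ℕ) (T : Cor22.ThetaVolumeDatumAt P l), ℤ → ℤ → ℕ → ∀ (j : (thetaIndex (X P l T)).Label) (vQ : (thetaIndex (X P l T)).VQ), Set ((logShellsDH (X P l T) (analyticLogv (Fld P l T))).Packet j vQ))
    (ballImage : ∀ (P : NFPoint) (l : ℕ) (T : Cor22.ThetaVolumeDatumAt P l), ℤ → ℤ → ∀ (j : (thetaIndex (X P l T)).Label) (vQ : (thetaIndex (X P l T)).VQ), Set ((logShellsDH (X P l T) (analyticLogv (Fld P l T))).Packet j vQ))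
    (thetaDiv : ∀ (P : NFPoint) (l : ℕ) (T : Cor22.ThetaVolumeDatumAt P l), ℤ → ℤ → LgpDivisor (M P l T) (thetaIndex (X P l T)).lstar)
    (n : ∀ (P : NFPoint) (l : ℕ) (T : Cor22.ThetaVolumeDatumAt P l), ℤ)
    {HT : ∀ (P : NFPoint) (l : ℕ) (T : Cor22.ThetaVolumeDatumAt P l), Type} {LogLink : ∀ (P : NFPoint) (l : ℕ) (T : Cor22.ThetaVolumeDatumAt P l), HT P l T → HT P l T → Type}
    {IsFull : ∀ (P : NFPoint) (l : ℕ) (T : Cor22.ThetaVolumeDatumAt P l), ∀ {s t : HT P l T}, LogLink P l T s t → Prop}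
    (lat : ∀ (P : NFPoint) (l : ℕ) (T : Cor22.ThetaVolumeDatumAt P l), LGPGaussianLogThetaLattice (LogLink P l T) (IsFull P l T))
    {Frd : ∀ (P : NFPoint) (l : ℕ) (T : Cor22.ThetaVolumeDatumAt P l), Type} {IsoF : ∀ (P : NFPoint) (l : ℕ) (T : Cor22.ThetaVolumeDatumAt P l), Frd P l T → Frd P l T → Type} {Ob : ∀ (P : NFPoint) (l : ℕ) (T : Cor22.ThetaVolumeDatumAt P l), Frd P l T → Type}
    {realify : ∀ (P : NFPoint) (l : ℕ) (T : Cor22.ThetaVolumeDatumAt P l), Frd P l T → Frd P l T} {Strip : ∀ (P : NFPoint) (l : ℕ) (T : Cor22.ThetaVolumeDatumAt P l), Type} {IsoS : ∀ (P : NFPoint) (l : ℕ) (T : Cor22.ThetaVolumeDatumAt P l), Strip P l T → Strip P l T → Type}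
    {Mv : ∀ (P : NFPoint) (l : ℕ) (T : Cor22.ThetaVolumeDatumAt P l), ∀ v : (thetaIndex (X P l T)).V, v ∈ (thetaIndex (X P l T)).Vbad → Type}
    [∀ P l T v h, Monoid (Mv P l T v h)]
    (sig : ∀ (P : NFPoint) (l : ℕ) (T : Cor22.ThetaVolumeDatumAt P l), GlobalLGPFrobenioidSignature (thetaIndex (X P l T)).lstar (thetaIndex (X P l T)).V (· ∈ (thetaIndex (X P l T)).Vbad) (Frd P l T) (IsoF P l T) (Ob P l T) (realify P l T)
        (Strip P l T) (IsoS P l T) (Mv P l T))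
    (split : ∀ (P : NFPoint) (l : ℕ) (T : Cor22.ThetaVolumeDatumAt P l), SplittingMonoids (Mv P l T))
    {ObΔ : ∀ (P : NFPoint) (l : ℕ) (T : Cor22.ThetaVolumeDatumAt P l), Type} {N : ∀ (P : NFPoint) (l : ℕ) (T : Cor22.ThetaVolumeDatumAt P l), ∀ v : (thetaIndex (X P l T)).V, v ∈ (thetaIndex (X P l T)).Vbad → Type}
    [∀ P l T v h, Monoid (N P l T v h)] (qData : ∀ (P : NFPoint) (l : ℕ) (T : Cor22.ThetaVolumeDatumAt P l), QPilotData (ObΔ P l T) (N P l T))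
    (t : ∀ (P : NFPoint) (l : ℕ) (T : Cor22.ThetaVolumeDatumAt P l), ∀ (pp : Nat.Primes) (_ : Fin (X P l T).lstar) (x : (thetaIndex (X P l T)).Fibre (.inr pp)), haveI : Fact (pp : ℕ).Prime := ⟨pp.2⟩; kOf (X P l T) pp.1 x)
    (tq : ∀ (P : NFPoint) (l : ℕ) (T : Cor22.ThetaVolumeDatumAt P l), ∀ (pp : Nat.Primes) (x : (thetaIndex (X P l T)).Fibre (.inr pp)), haveI : Fact (pp : ℕ).Prime := ⟨pp.2⟩; kOf (X P l T) pp.1 x)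
    (ρ : ∀ (P : NFPoint) (l : ℕ) (T : Cor22.ThetaVolumeDatumAt P l), (∀ v : (thetaIndex (X P l T)).V, v ∈ (thetaIndex (X P l T)).Vbad → Set ((logShellsDH (X P l T) (analyticLogv (Fld P l T))).StarPacket v)) → ∀ (j : (thetaIndex (X P l T)).Label) (vQ : (thetaIndex (X P l T)).VQ), Set ((logShellsDH (X P l T) (analyticLogv (Fld P l T))).Packet j vQ))
    (qK : ∀ (P : NFPoint) (l : ℕ) (T : Cor22.ThetaVolumeDatumAt P l), ∀ v : (thetaIndex (X P l T)).V, v ∈ (thetaIndex (X P l T)).Vbad → Set ((logShellsDH (X P l T) (analyticLogv (Fld P l T))).StarPacket v))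
    -- [SIDE] setting-forming conditions only: the ideles are non-zero and units off `S` (NO realisation demanded)
    (htq0 : ∀ P l T pp x, tq P l T pp x ≠ 0)
    (htq1 : ∀ (P : NFPoint) (l : ℕ) (T : Cor22.ThetaVolumeDatumAt P l), ∀ (pp : Nat.Primes) (x : (thetaIndex (X P l T)).Fibre (.inr pp)),
        haveI : Fact (pp : ℕ).Prime := ⟨pp.2⟩; placeOf (X P l T) pp.1 x ∉ (X P l T).S → ‖tq P l T pp x‖ = 1)
    (ht0 : ∀ P l T pp i x, t P l T pp i x ≠ 0)
    (ht1 : ∀ (P : NFPoint) (l : ℕ) (T : Cor22.ThetaVolumeDatumAt P l), ∀ (pp : Nat.Primes) (i : Fin (X P l T).lstar) (x : (thetaIndex (X P l T)).Fibre (.inr pp)),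
        haveI : Fact (pp : ℕ).Prime := ⟨pp.2⟩; placeOf (X P l T) pp.1 x ∉ (X P l T).S → ‖t P l T pp i x‖ = 1)
    -- [S_H] the HULL-LEVEL form of the printed clause, at every datum, AT THESE DATA
    (hSH : ∀ (P : NFPoint) (l : ℕ) (T : Cor22.ThetaVolumeDatumAt P l), Cor312Vol.PilotKummerCompatHull
        (LatticeSituation.ofShells (logShellsDH (X P l T) (analyticLogv (Fld P l T))) (M P l T) (archPk P l T)
          (archSub P l T) (summandPiecesPr (X P l T) (logvAnalytic_analyticLogv (F := Fld P l T))).Adm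
          (summandPiecesPr (X P l T) (logvAnalytic_analyticLogv (F := Fld P l T))).logvol (Ψ P l T) (act P l T) (Mmod P l T)
          (region P l T) (frobAdm P l T) (frobLogvol P l T) (frobΨ P l T) (frobMmod P l T) (unitImage P l T)
          (ballImage P l T) (thetaDiv P l T))
        (settingPrVolSharp (X P l T) (logvAnalytic_analyticLogv (F := Fld P l T)) (M P l T) (archPk P l T) (archSub P l T) (Ψ P l T)
          (act P l T) (Mmod P l T) (region P l T) (n P l T) (lat P l T) (sig P l T) (split P l T) (qData P l T) (tq P l T)
          (t P l T) (htq0 P l T) (htq1 P l T)) (ρ P l T) (qK P l T))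
    -- [PIN] the q-pin (pq′) ONLY
    (hQPin : ∀ (P : NFPoint) (l : ℕ) (T : Cor22.ThetaVolumeDatumAt P l), Cor312Vol.QPinned
        (LatticeSituation.ofShells (logShellsDH (X P l T) (analyticLogv (Fld P l T))) (M P l T) (archPk P l T)
          (archSub P l T) (summandPiecesPr (X P l T) (logvAnalytic_analyticLogv (F := Fld P l T))).Adm
          (summandPiecesPr (X P l T) (logvAnalytic_analyticLogv (F := Fld P l T))).logvol (Ψ P l T) (act P l T) (Mmod P l T)
          (region P l T) (frobAdm P l T) (frobLogvol P l T) (frobΨ P l T) (frobMmod P l T) (unitImage P l T)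
          (ballImage P l T) (thetaDiv P l T))
        (settingPrVolSharp (X P l T) (logvAnalytic_analyticLogv (F := Fld P l T)) (M P l T) (archPk P l T) (archSub P l T) (Ψ P l T)
          (act P l T) (Mmod P l T) (region P l T) (n P l T) (lat P l T) (sig P l T) (split P l T) (qData P l T) (tq P l T)
          (t P l T) (htq0 P l T) (htq1 P l T)) (ρ P l T) (qK P l T))
    -- [FACT] (none) · [CONE] the hull-volume estimate with `B_III` for the NON-slot-constant data ONLY (c312-8 p428563's `hreg`, verbatim)
    (hreg : ∀ P : NFPoint, P ∈ UP → ∀ l : ℕ, l.Prime → 5 ≤ l →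
      Cor22.AdmitsCore P → Cor22.CondP2 P l → Cor22.CondP5 P l → Cor22.CondP6 P l →
      ∀ T : Cor22.ThetaVolumeDatumAt P l,
        (letI := T.instFieldF; letI := T.instNumberFieldF; letI := T.instAlgebraF; letI := T.instFieldK
         letI := T.instNumberFieldK; letI := T.instAlgebraK; letI := T.instFieldFbar; letI := T.instAlgebraFbar
         letI := T.instAlgebraKFbar; letI := T.instIsElliptic
         ¬ (∀ p ∈ T.I.supportPrimes, ∀ v w : placesOver (fieldOfModuli T.E) p,
            (Summit.ABC.IUTFork.DHData.ofInput T.I).logQloc p v = (Summit.ABC.IUTFork.DHData.ofInput T.I).logQloc p w)) →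
        T.HullEstimateOf
          (((l : ℝ) + 1) / 4 *
            ((1 + 12 * (Cor22.dmod P : ℝ) / l) * (P.logDiff + Cor22.logCondAvoid P {2, l})
              + 2 * Real.log l + 52
              + 20 / 3 * Real.log (((2 ^ 12 * 3 ^ 3 * 5 * Cor22.dmod P : ℕ) : ℝ) * (l : ℝ))
                * (Nat.primeCounting (2 ^ 12 * 3 ^ 3 * 5 * Cor22.dmod P * l) : ℝ))))
    -- [READ] the two NUMBER identifications, explicit again: the setting's `−|log(q)|` IS the datum's; its `−|log(Θ)|` is ≤ the datum's
    (hq : ∀ (P : NFPoint) (l : ℕ) (T : Cor22.ThetaVolumeDatumAt P l), (settingPrVolSharp (X P l T) (logvAnalytic_analyticLogv (F := Fld P l T)) (M P l T) (archPk P l T) (archSub P l T) (Ψ P l T)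
          (act P l T) (Mmod P l T) (region P l T) (n P l T) (lat P l T) (sig P l T) (split P l T) (qData P l T) (tq P l T)
          (t P l T) (htq0 P l T) (htq1 P l T)).negLogQ = T.negAbsLogQ)
    (hΘ : ∀ (P : NFPoint) (l : ℕ) (T : Cor22.ThetaVolumeDatumAt P l), (settingPrVolSharp (X P l T) (logvAnalytic_analyticLogv (F := Fld P l T)) (M P l T) (archPk P l T) (archSub P l T) (Ψ P l T)
          (act P l T) (Mmod P l T) (region P l T) (n P l T) (lat P l T) (sig P l T) (split P l T) (qData P l T) (tq P l T)
          (t P l T) (htq0 P l T) (htq1 P l T)).negLogTheta ≤ ((T.negLogTheta : ℝ) : WithTop ℝ)) :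
    _root_.ABC := by
  -- Step 1–2: [IUTchIII] Cor 3.12 at EVERY genuine Θ-volume datum on the HULL-LEVEL line, over the free base field
  have h312 : ∀ (P : NFPoint) (l : ℕ), Cor22.Cor312AtDatum P l := fun P l T =>
    Shrink4.le_of_SH (X P l T) (M P l T) (archPk P l T) (archSub P l T) (Ψ P l T) (act P l T) (Mmod P l T) (region P l T)
      (frobAdm P l T) (frobLogvol P l T) (frobΨ P l T) (frobMmod P l T) (unitImage P l T) (ballImage P l T) (thetaDiv P l T) (n P l T)
      (lat P l T) (sig P l T) (split P l T) (qData P l T) (t P l T) (tq P l T) (ρ P l T) (qK P l T) (htq0 P l T) (htq1 P l T) (ht0 P l T)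
      (ht1 P l T) (hSH P l T) (hQPin P l T) (hq P l T) (hΘ P l T)
  -- Step 3: the (U)-line capstone — slot-constant data PROVED inside, GenEllTwo discharged by name (c312-8 p428563)
  exact ThetaPartII.ABC_of_cor312_of_hullRegime (fun P _ l _ _ _ _ _ _ => h312 P l) hreg

end Family

end Summit.ABC.IUTFork.Conditional

end
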